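import Summits.AtomisticToContinuum.Crystallization.Theses.GappedShellCensus

/-!
# `ShellCensus` (stmt-AtomisticToContinuum-15929), negative side I: matchings and near-neighbour degrees

Witness-independent lemmas behind the refutation of `GappedShellCensus.ShellCensus`
(`Theorems/GappedShellCensusShellCensusRefutation.lean`):

* `exists_map_of_etaMatched`, `five_le_card_near`, `card_near_image` — an `η`-matching of a shell
  `T` with an isometric copy `A(P)` of a pattern is an injective map moving points by `≤ η`, hence
  changing pairwise distances by `≤ 2η`; a shell point with five shell points within `β` is sent
  to a pattern point with five pattern points within any `ρ > β + 2η`, and such counts are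
  invariant under the isometry `A`.
* `not_shellCloseTo_of_degree` — the DEGREE OBSTRUCTION: if every pattern point has at most four
  other pattern points within `ρ`, a shell with a "five-valent" point (`β + 2η < ρ`) is not
  `η`-close to the pattern.
* `fcc_near`, `hcp_near` — every point of `fccKissingPattern` / `hcpKissingPattern` has at most four
  other pattern points within `1.414 < √2` (integer models, `decide`).
* `norm_div_intVec`, `dist_div_intVec`, `le_sqrt_div`, `sqrt_div_le` — transfer of integer
  squared-norm facts to a `D⁻¹`-scaled integer witness in `ℝ³`.

None of these concludes a route item positively (negative-side support, refuter seat
refuter-rattack-stmt-AtomisticToContinuum-15929-0, 2026-08-16).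
-/

noncomputable section

namespace Summit.AtomisticToContinuum.Crystallization.Theorems.ShellCensusNegative

open Literature.Geometry.DiscreteGeometry

/-- An `η`-matching `T ≃ Q` yields a map `ℝ³ → ℝ³` sending `T` injectively into `Q` and moving
each point of `T` by at most `η`. [folklore] -/
theorem exists_map_of_etaMatched {η : ℝ} {T Q : Finset (EuclideanSpace ℝ (Fin 3))} (h : EtaMatched η T Q) :
    ∃ f : (EuclideanSpace ℝ (Fin 3)) → (EuclideanSpace ℝ (Fin 3)), (∀ t ∈ T, f t ∈ Q) ∧ (∀ t ∈ T, ∀ t' ∈ T, f t = f t' → t = t') ∧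
      ∀ t ∈ T, dist t (f t) ≤ η := by
  obtain ⟨e, he⟩ := h
  classical
  refine ⟨fun x => if hx : x ∈ T then ((e ⟨x, hx⟩ : ↥Q) : (EuclideanSpace ℝ (Fin 3))) else x, ?_, ?_, ?_⟩
  · intro t ht
    simp only [ht, dif_pos]
    exact (e ⟨t, ht⟩).2
  · intro t ht t' ht' hEq
    simp only [ht, ht', dif_pos] at hEq
    have h1 : e ⟨t, ht⟩ = e ⟨t', ht'⟩ := Subtype.ext hEq
    exact congrArg Subtype.val (e.injective h1)
  · intro t ht
    simp only [ht, dif_pos]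
    exact he ⟨t, ht⟩

/-- If `f` maps `T` injectively into `Q` moving points by `≤ η`, `t0 ∈ T` has five other points of
`T` within `β`, and `β + 2η < ρ`, then `f t0` has at least five other points of `Q` within `ρ`. [folklore] -/
theorem five_le_card_near {η β ρ : ℝ} {T Q : Finset (EuclideanSpace ℝ (Fin 3))} (f : (EuclideanSpace ℝ (Fin 3)) → (EuclideanSpace ℝ (Fin 3)))
    (hfQ : ∀ t ∈ T, f t ∈ Q) (hfinj : ∀ t ∈ T, ∀ t' ∈ T, f t = f t' → t = t')
    (hfd : ∀ t ∈ T, dist t (f t) ≤ η) (hβ : β + 2 * η < ρ)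
    {t0 : (EuclideanSpace ℝ (Fin 3))} (ht0 : t0 ∈ T) (N : Finset (EuclideanSpace ℝ (Fin 3))) (hNT : N ⊆ T) (hN0 : t0 ∉ N) (hNcard : N.card = 5)
    (hNd : ∀ t ∈ N, dist t0 t ≤ β) :
    5 ≤ (Q.filter fun b => b ≠ f t0 ∧ dist (f t0) b < ρ).card := by
  classical
  have hinj : Set.InjOn f ↑N := fun x hx y hy h => hfinj x (hNT hx) y (hNT hy) h
  calc 5 = N.card := hNcard.symm
    _ = (N.image f).card := (Finset.card_image_of_injOn hinj).symm
    _ ≤ _ := Finset.card_le_card ?_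
  intro b hb
  rw [Finset.mem_image] at hb
  obtain ⟨t, htN, rfl⟩ := hb
  rw [Finset.mem_filter]
  refine ⟨hfQ t (hNT htN), ?_, ?_⟩
  · intro h
    have := hfinj t (hNT htN) t0 ht0 h
    exact hN0 (this ▸ htN)
  · calc dist (f t0) (f t) ≤ dist (f t0) t0 + dist t0 t + dist t (f t) := dist_triangle4 _ _ _ _
      _ ≤ η + β + η := by
          gcongr
          · rw [dist_comm]; exact hfd t0 ht0
          · exact hNd t htN
          · exact hfd t (hNT htN)
      _ < ρ := by linarith

/-- Near-neighbour counts are invariant under a linear isometry of the pattern. [folklore] -/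
theorem card_near_image (P : Finset (EuclideanSpace ℝ (Fin 3))) (A : (EuclideanSpace ℝ (Fin 3)) →ₗᵢ[ℝ] (EuclideanSpace ℝ (Fin 3))) (a : (EuclideanSpace ℝ (Fin 3))) (ρ : ℝ) :
    ((P.image A).filter fun b => b ≠ A a ∧ dist (A a) b < ρ).card
      = (P.filter fun b => b ≠ a ∧ dist a b < ρ).card := by
  classical
  rw [Finset.filter_image, Finset.card_image_of_injective _ A.injective]
  congr 1
  apply Finset.filter_congr
  intro b _
  simp [A.injective.ne_iff, LinearIsometry.dist_map]

/-- The degree obstruction: if every point of the pattern `P` has at most four other pattern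
points within `ρ`, while the shell `T` has a point with five other shell points within `β`,
`β + 2η < ρ`, then `T` is not `η`-close to `P`. [folklore] -/
theorem not_shellCloseTo_of_degree {η β ρ : ℝ} {T P : Finset (EuclideanSpace ℝ (Fin 3))}
    (hP : ∀ a ∈ P, (P.filter fun b => b ≠ a ∧ dist a b < ρ).card ≤ 4)
    (hβ : β + 2 * η < ρ) {t0 : (EuclideanSpace ℝ (Fin 3))} (ht0 : t0 ∈ T) (N : Finset (EuclideanSpace ℝ (Fin 3))) (hNT : N ⊆ T) (hN0 : t0 ∉ N)
    (hNcard : N.card = 5) (hNd : ∀ t ∈ N, dist t0 t ≤ β) : ¬ ShellCloseTo η T P := by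
  classical
  rintro ⟨A, hA⟩
  obtain ⟨f, hfQ, hfinj, hfd⟩ := exists_map_of_etaMatched hA
  have h5 := five_le_card_near f hfQ hfinj hfd hβ ht0 N hNT hN0 hNcard hNd
  obtain ⟨a, ha, hfa⟩ := Finset.mem_image.1 (hfQ t0 ht0)
  rw [← hfa, card_near_image] at h5
  have := hP a ha
  omega

/-- Distances in a scaled integer model: `dist (c•v) (c•w) = c √|v − w|²`. [folklore] -/
theorem dist_scaled_intVec (c : ℝ) (hc : 0 ≤ c) (v w : Fin 3 → ℤ) :
    dist (c • intVec v) (c • intVec w) = c * Real.sqrt (sqNormInt (v - w) : ℝ) := by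
  rw [dist_eq_norm, ← smul_sub, intVec_sub, norm_smul, Real.norm_of_nonneg hc, norm_intVec]

/-- For the pattern `scaledPattern S N = {v/√N}`: if in the integer model every point has at most
four others at squared distance `< M`, and `ρ² N ≤ M`, then every pattern point has at most four
other pattern points within distance `ρ`. [folklore] -/
theorem card_near_scaledPattern_le {S : Finset (Fin 3 → ℤ)} {N : ℕ} (hN : N ≠ 0) {M : ℤ}
    (hS : ∀ v ∈ S, (S.filter fun w => w ≠ v ∧ sqNormInt (v - w) < M).card ≤ 4)
    {ρ : ℝ} (hρ0 : 0 ≤ ρ) (hρ : ρ ^ 2 * N ≤ M) :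
    ∀ a ∈ scaledPattern S N, ((scaledPattern S N).filter fun b => b ≠ a ∧ dist a b < ρ).card ≤ 4 := by
  classical
  intro a ha
  obtain ⟨v, hv, rfl⟩ := Finset.mem_image.1 ha
  unfold scaledPattern
  rw [Finset.filter_image, Finset.card_image_of_injective _ (scaledPattern_map_injective hN)]
  refine le_trans (Finset.card_le_card ?_) (hS v hv)
  intro w hw
  rw [Finset.mem_filter] at hw ⊢
  obtain ⟨hwS, hne, hd⟩ := hw
  refine ⟨hwS, ?_, ?_⟩
  · rintro rfl; exact hne rfl
  · have hNpos : (0 : ℝ) < N := by exact_mod_cast Nat.pos_of_ne_zero hN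
    have hc : (0 : ℝ) ≤ (Real.sqrt N)⁻¹ := by positivity
    rw [dist_scaled_intVec _ hc] at hd
    have hsN : 0 < Real.sqrt N := Real.sqrt_pos.2 hNpos
    rw [inv_mul_lt_iff₀ hsN] at hd
    have h2 : (sqNormInt (v - w) : ℝ) < (Real.sqrt N * ρ) ^ 2 := by
      by_contra hcon
      push Not at hcon
      have : Real.sqrt N * ρ ≤ Real.sqrt (sqNormInt (v - w) : ℝ) := by
        calc Real.sqrt N * ρ = Real.sqrt ((Real.sqrt N * ρ) ^ 2) := by
              rw [Real.sqrt_sq (by positivity)]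
          _ ≤ _ := Real.sqrt_le_sqrt hcon
      linarith
    rw [mul_pow, Real.sq_sqrt hNpos.le, mul_comm] at h2
    have h3 : (sqNormInt (v - w) : ℝ) < (M : ℝ) := lt_of_lt_of_le h2 hρ
    exact_mod_cast h3

/-- Integer fcc model: every vector has at most four others at squared distance `< 4` (i.e. the
pattern has four points at distance `1` around each point, the next distance being `√2`).
[cite: ConwaySloane1999, Ch. 4 §6.3] -/
theorem fccInt_near : ∀ v ∈ fccInt, (fccInt.filter fun w => w ≠ v ∧ sqNormInt (v - w) < 4).card ≤ 4 := by
  decide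

/-- Integer hcp model (scale `√18`): every vector has at most four others at squared distance `< 36`.
[folklore] -/
theorem hcpInt_near : ∀ v ∈ hcpInt, (hcpInt.filter fun w => w ≠ v ∧ sqNormInt (v - w) < 36).card ≤ 4 := by
  decide

/-- Every point of the fcc pattern has at most four other pattern points within `1.414 < √2`. [folklore] -/
theorem fcc_near : ∀ a ∈ fccKissingPattern,
    (fccKissingPattern.filter fun b => b ≠ a ∧ dist a b < 1.414).card ≤ 4 :=
  card_near_scaledPattern_le two_ne_zero fccInt_near (by norm_num) (by norm_num)

/-- Every point of the hcp pattern has at most four other pattern points within `1.414 < √2`. [folklore] -/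
theorem hcp_near : ∀ a ∈ hcpKissingPattern,
    (hcpKissingPattern.filter fun b => b ≠ a ∧ dist a b < 1.414).card ≤ 4 :=
  card_near_scaledPattern_le (by norm_num) hcpInt_near (by norm_num) (by norm_num)

/-- Norm of a `D⁻¹`-scaled integer vector. [folklore] -/
theorem norm_div_intVec (D : ℕ) (v : Fin 3 → ℤ) :
    ‖(((D : ℝ)⁻¹) • intVec v : (EuclideanSpace ℝ (Fin 3)))‖ = Real.sqrt (sqNormInt v : ℝ) / D := by
  have hc : (0 : ℝ) ≤ ((D : ℝ)⁻¹) := by positivity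
  rw [norm_smul, Real.norm_of_nonneg hc, norm_intVec, inv_mul_eq_div]

/-- Distance of two `D⁻¹`-scaled integer vectors. [folklore] -/
theorem dist_div_intVec (D : ℕ) (v w : Fin 3 → ℤ) :
    dist (((D : ℝ)⁻¹) • intVec v : (EuclideanSpace ℝ (Fin 3))) (((D : ℝ)⁻¹) • intVec w)
      = Real.sqrt (sqNormInt (v - w) : ℝ) / D := by
  have hc : (0 : ℝ) ≤ ((D : ℝ)⁻¹) := by positivity
  rw [dist_scaled_intVec _ hc, inv_mul_eq_div]

/-- `lo ≤ √q / D` from `(lo·D)² ≤ q`. [folklore] -/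
theorem le_sqrt_div {lo : ℝ} {D : ℕ} (hD : D ≠ 0) {q : ℝ} (hlo : 0 ≤ lo)
    (h : (lo * D) ^ 2 ≤ q) : lo ≤ Real.sqrt q / D := by
  have hDpos : (0 : ℝ) < D := by exact_mod_cast Nat.pos_of_ne_zero hD
  rw [le_div_iff₀ hDpos]
  calc lo * D = Real.sqrt ((lo * D) ^ 2) := by rw [Real.sqrt_sq (by positivity)]
    _ ≤ Real.sqrt q := Real.sqrt_le_sqrt h

/-- `√q / D ≤ hi` from `q ≤ (hi·D)²`. [folklore] -/
theorem sqrt_div_le {hi : ℝ} {D : ℕ} (hD : D ≠ 0) {q : ℝ} (hhi : 0 ≤ hi)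
    (h : q ≤ (hi * D) ^ 2) : Real.sqrt q / D ≤ hi := by
  have hDpos : (0 : ℝ) < D := by exact_mod_cast Nat.pos_of_ne_zero hD
  rw [div_le_iff₀ hDpos]
  calc Real.sqrt q ≤ Real.sqrt ((hi * D) ^ 2) := Real.sqrt_le_sqrt h
    _ = hi * D := Real.sqrt_sq (by positivity)

end Summit.AtomisticToContinuum.Crystallization.Theorems.ShellCensusNegative

end
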